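/-
Copyright (c) 2026 the pub-hodgecm-mathlib formalisation cell (harness21).  Prover seat hodgecm-mathlib-K2E1-p13 (g4), Track B ∕ K2-LIT, h413 = `stmt-HodgeConjecture-24833`,
R90-TF section S8 «ContSpec-n½», #2 chain (G side), deal S8-R72∕R79∕R118 of R90-CS-plan (g2), (XF)₃ sub-cut C4a (census `R90/S8/CENSUS-XF3.K2E1-p13-g4.md`): the DICHOTOMY ENGINE and the two
`B(F)`-weighted brackets `[Ψ₁]_β = [Ψ₂]_β = 0` of the unfolded inner product of non-associate twisted pseudo-Eisenstein series on `U(2,1)_{L∕L⁺}`.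
-/
import Summits.HodgeConjecture.HodgeConjecture.Theorems.K2E1ChiPseudoEisensteinIdeleSplitCMThree         -- ★ C3 p863105 (this seat): torus scaling, `w₀` `K_U`-average, middle-entry torus character, radial finiteness, uniform `w₀` bound; brings ★ C1
import Summits.HodgeConjecture.HodgeConjecture.Theorems.K2E1EisensteinPairingFibreWeightU3            -- ★ C3′ p863087 (this seat): the `U(1)`-fibre kills a weighted bracket; brings ★ (δ)₃, ★ (C-G)
import Summits.HodgeConjecture.HodgeConjecture.Theorems.K2E1ChiPseudoEisensteinIdeleSplitCMTwo           -- ★ H-a (K2E3-p12): `norm_reflectChar_apply_of_isUnitary`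
import Summits.HodgeConjecture.HodgeConjecture.Theorems.K2E1IdeleClassCharacterOrthogonality            -- ★ GR-χ p860004 (K2E3-p12): Lemma B `setIntegral_ideleClass_smul_mul_eq_zero_of_not_isNormTwist`, `apply_mul_conj_apply_of_isUnitary`
import HarnessLib

/-!
# (XF)₃ C4a — `K2E1ChiPseudoEisensteinWeightBracketsCMThree`: THE DICHOTOMY ENGINE «`U(1)`-FIBRE OR LEMMA B» AND THE TWO WEIGHTED BRACKETS OF THE UNFOLDED INNER PRODUCT

Track B ∕ K2-LIT, crux h413 = `stmt-HodgeConjecture-24833`, route of record `HCCMUnconditional`; cell `hodgecm-mathlib`, R90-TF programme, section S8, #2 chain, letter (XF)₃ of ★ R6₃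
«of letters» (p862757).  THEOREMS ONLY (no `def`, no `instance`, no `notation`, no named-fact hypothesis, no `sorry`; default heartbeats); lane `--supports stmt-HodgeConjecture-24833
--as helper` (count-neutral).

THE MATHEMATICS ([MoeglinWaldspurger1995] II.2.1; [Rogawski1990] §7.3 pp. 96–98; [TateThesis1967] Thm. 4.4.1).  After unfolding and averaging (C4b), the inner product of `θ_{f,φ}` (pair data
`(χ₁,χ₂)`) and `θ_{f′,φ′}` (pair data `(χ₁′,χ₂′)`) on `U(J₃)` is `c_μ([Ψ₁]_β + [Ψ₂]_β)` with `Ψ₁ = (f∘H)φ·conj((f′∘H)φ′)` and `Ψ₂ = (f∘H)φ·conj J`, `J = θ′_B − (f′∘H)φ′ =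
(ν𝓕)⁻¹•∫_{N(𝔸)}(f′∘H)(w₀v·)φ′(w₀v·)dν`.  Along `t·K_U` both `K_U`-averages have the shape `η(t)·(χ₁·conj ξ)(d₀t)·R(d₀t)` with the SAME middle-entry torus character `η = (χ₂conj χ₂′)∘(·)₁₁`
(★ C3 `exists_middleEntryChar`), `ξ = χ₁′` resp. `χ₁′ʷ` (★ C1, ★ C3 §2), `R` radial.
* §1 ENGINE (generic quadratic `E/F`) **`integral_weight_smul_eq_zero_of_kAverage_pairChar`**: such a bracket VANISHES as soon as `χ₂ ≠ χ₂′` (then `η ≠ 1` on the fibre `ker d₀`, ★ C3 §3 +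
  unitarity of automorphic `χ₂′` ★, and ★ C3′ kills it) OR `χ₁ξ⁻¹` is not a norm twist (then, if `χ₂ = χ₂′`, `η ≡ 1`, ★ (δ)₃ pushes the bracket to `E^×∖𝕀_E` and ★ GR-χ Lemma B with the
  weight `(‖x‖·‖x‖)⁻¹` kills it).
* §2 (CM) **`integral_weight_smul_wOne_eq_zero_cm_three`** (`[Ψ₁]_β = 0` unless `χ₂ = χ₂′` and `χ₁χ₁′⁻¹` is a norm twist) and **`integral_weight_smul_wZero_eq_zero_cm_three`** (`[Ψ₂]_β = 0`
  unless `χ₂ = χ₂′` and `χ₁(χ₁′ʷ)⁻¹` is a norm twist; `J` enters with its ★ invariances as hypotheses and the formula `hJ`), both with integrability, for CONTINUOUS profiles `f, f′ ∈ C_c((0,∞))`.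
HONEST LABEL: HC_CM is proved only modulo the 7 printed citations (2 remaining named inputs: hLiu418 = `stmt-HodgeConjecture-24832`, h413 = `stmt-HodgeConjecture-24833`) until rung 0
closes; REL ≠ ★ ≠ BUILT; this file asserts no named fact and closes no socket; count-neutral; letter-free.

## References
* [MoeglinWaldspurger1995] C. Mœglin, J.-L. Waldspurger, *Spectral Decomposition and Eisenstein Series* (1995), II.2.1, IV.2.
* [Rogawski1990] J. D. Rogawski, *Automorphic Representations of Unitary Groups in Three Variables* (1990), §7.3 (pp. 96–98), §13.9 p. 229.
* [TateThesis1967] J. Tate, *Fourier analysis in number fields and Hecke's zeta-functions*, in Cassels–Fröhlich (1967), Thm. 4.4.1.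
-/

set_option autoImplicit false
set_option linter.dupNamespace false  -- the mandated namespace repeats the summit's segment (`HodgeConjecture.HodgeConjecture`)

noncomputable section

open MeasureTheory Measure Set Filter Topology Complex NumberField IsDedekindDomain MulAction
open scoped Real NNReal ENNReal ComplexConjugate
open Literature.MeasureTheory.Group Literature.NumberTheory
open Literature.NumberTheory.Automorphic Literature.NumberTheory.Automorphic.UnitaryGroup AdelicGroupData
open Literature.NumberTheory.GaloisRepresentations (HeckeCharacter ideleGroup)
open Literature.NumberTheory.Automorphic.Arthur2013.Leaves.TECR
open Summit.HodgeConjecture.HodgeConjecture.Cruxes.H413.K2E1BorelEisensteinU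
open Summit.HodgeConjecture.HodgeConjecture.Cruxes.H413.K2E1CharacterEisensteinU2Defs
open Summit.HodgeConjecture.HodgeConjecture.Cruxes.H413.K2E1CharacterEisensteinU3PairDefs
open Summit.HodgeConjecture.HodgeConjecture.Cruxes.H413.K2E1PseudoEisensteinRadialCMTwo (exists_one_le_forall_eq_zero)
open Summit.HodgeConjecture.HodgeConjecture.Cruxes.H413.K2E1ChiSectionTorusAverageU3 (apply_torus_mul_of_isChiSectionPair borelHeight_torus_mul_maximalCompact_three integral_maximalCompact_torus_chiSectionPair_mul_conj)
open Summit.HodgeConjecture.HodgeConjecture.Cruxes.H413.K2E1ChiPseudoEisensteinIdeleSplitCMThree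
open Summit.HodgeConjecture.HodgeConjecture.Cruxes.H413.K2E1EisensteinPairingFibreWeightU3 (integral_weight_smul_eq_zero_of_kAverage_eq_character_mul_three)
open Summit.HodgeConjecture.HodgeConjecture.Cruxes.H413.K2E1EisensteinPairingUnfoldedWeight (exists_integral_weight_smul_eq_mul_setIntegral_ideleClass_three)
open Summit.HodgeConjecture.HodgeConjecture.Cruxes.H413.K2E1ChiPseudoEisensteinIdeleSplitCMTwo (norm_reflectChar_apply_of_isUnitary)
open Summit.HodgeConjecture.HodgeConjecture.Cruxes.H413.K2E1IdeleClassCharacterOrthogonality (setIntegral_ideleClass_smul_mul_eq_zero_of_not_isNormTwist apply_mul_conj_apply_of_isUnitary)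

namespace Summit.HodgeConjecture.HodgeConjecture.Cruxes.H413.K2E1ChiPseudoEisensteinWeightBracketsCMThree

/-! ## §1 The ENGINE (generic quadratic `E/F`): a weighted bracket with `K_U`-average `(χ₂conj χ₂′)(t₁₁)·(χ₁conj ξ)(d₀t)·R(d₀t)` vanishes unless `χ₂ = χ₂′` and `χ₁ξ⁻¹` is a norm twist -/

section Engine

variable {F E : Type} [Field F] [NumberField F] [Field E] [NumberField E] [Algebra F E] {c : E ≃ₐ[F] E}
variable [MeasurableSpace (quasiSplit F E c 3).Adelic] [BorelSpace (quasiSplit F E c 3).Adelic]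
  [MeasurableSpace (AdeleRing (𝓞 E) E)ˣ] [BorelSpace (AdeleRing (𝓞 E) E)ˣ]

/-- **THE DICHOTOMY ENGINE «`U(1)`-FIBRE OR LEMMA B».**  `G = U(J₃)`, `[E:F] = 2`, `c² = 1`, `c ≠ 1`; `ν_G`, `μ_K`, `ν_I` Haar, Iwasawa `hBK`, `𝓕` an idele class domain, `β` a covering weight of
`B(F)♯`.  Let `Ψ` be Borel, left-`N(𝔸)`- and left-`B(F)`-invariant, with `K_U`-average `∫_{K_U}Ψ(tk)dμ_K = (χ₂(t₁₁)·conj χ₂′(t₁₁))·((χ₁(d₀t)·conj ξ(d₀t))·R(d₀t))` for Hecke characters `χ₁`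
and UNITARY `ξ`, AUTOMORPHIC `U(1)`-characters `χ₂, χ₂′`, and a Borel norm-one-invariant `R : 𝕀_E → ℂ`; let `Φm ≥ ‖Ψ(tk)‖` be a Borel `E^×`-invariant majorant with `∫⁻_𝓕 (‖x‖·‖x‖)⁻¹Φm < ∞`.
IF `χ₂ ≠ χ₂′` OR `χ₁·ξ⁻¹` is not a norm twist, THEN `(β).toReal • Ψ ∈ L¹(ν_G)` and **`∫ (β g).toReal • Ψ g dν_G = 0`** — `χ₂ ≠ χ₂′`: the middle-entry character `η` (★ C3) is unitary, trivial
on the rational torus and `≠ 1` somewhere on `ker d₀` (★ C3 §3, unitarity ★ `norm_torusHom_apply_eq_one_of_isAutomorphic`), so ★ C3′ applies; `χ₂ = χ₂′`: `η ≡ 1`, ★ (δ)₃ and ★ GR-χ Lemma B.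
[cite: MoeglinWaldspurger1995, II.2.1] [cite: Rogawski1990, §7.3 (pp. 96–98)] [cite: TateThesis1967, Thm. 4.4.1] -/
theorem integral_weight_smul_eq_zero_of_kAverage_pairChar (h2 : Module.finrank F E = 2) (hc : c * c = 1) (hc1 : c ≠ 1)
    (νG : Measure (quasiSplit F E c 3).Adelic) [νG.IsHaarMeasure]
    (μK : Measure ((standardMaximalCompactGL 3 E).comap (adelicVal F E c 3 ((StdForm.antidiagonal 3).over E)) : Subgroup (quasiSplit F E c 3).Adelic)) [μK.IsHaarMeasure] (νI : Measure (AdeleRing (𝓞 E) E)ˣ) [νI.IsHaarMeasure]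
    (hBK : ∀ g : (quasiSplit F E c 3).Adelic, ∃ b ∈ borelAdelic F E c 3, ∃ k : (quasiSplit F E c 3).Adelic, adelicVal F E c 3 ((StdForm.antidiagonal 3).over E) k ∈ standardMaximalCompactGL 3 E ∧ g = b * k)
    {𝓕 : Set (AdeleRing (𝓞 E) E)ˣ} (h𝓕 : IsIdeleClassDomain E 𝓕)
    {β : (quasiSplit F E c 3).Adelic → ℝ≥0∞} (hβ : IsCoveringWeight ((arithmeticBorel F E c 3).map (quasiSplit F E c 3).arithmeticSubgroup.subtype) β)
    {Ψ : (quasiSplit F E c 3).Adelic → ℂ} (hΨm : Measurable Ψ)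
    (hΨN : ∀ (n : unipotentInBorel F E c 3) (y : (quasiSplit F E c 3).Adelic), Ψ (((n : borelAdelic F E c 3) : (quasiSplit F E c 3).Adelic) * y) = Ψ y)
    (hΨB : ∀ b ∈ arithmeticBorel F E c 3, ∀ y : (quasiSplit F E c 3).Adelic, Ψ ((b : (quasiSplit F E c 3).Adelic) * y) = Ψ y)
    {χ₁ ξ : HeckeCharacter E} (hξu : ξ.IsUnitary) {χ₂ χ₂' : ↥(TorusDict.torus c) →ₜ* ℂˣ} (hχ₂ : TorusDict.IsAutomorphic c χ₂) (hχ₂' : TorusDict.IsAutomorphic c χ₂')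
    (hna : χ₂ ≠ χ₂' ∨ ¬ (χ₁ * ξ⁻¹).IsNormTwist)
    {R : (AdeleRing (𝓞 E) E)ˣ → ℂ} (hRm : Measurable R) (hR : ∀ a : (AdeleRing (𝓞 E) E)ˣ, IdeleClassGroup.ideleNorm E a = 1 → ∀ x, R (a * x) = R x)
    (hK : ∀ t : ↥(torusInBorel F E c 3), ∫ k, Ψ (((t : borelAdelic F E c 3) : (quasiSplit F E c 3).Adelic) * (k : (quasiSplit F E c 3).Adelic)) ∂μK =
      (((χ₂ (middleEntryUnitary (t : borelAdelic F E c 3).2) : ℂˣ) : ℂ) * conj ((χ₂' (middleEntryUnitary (t : borelAdelic F E c 3).2) : ℂˣ) : ℂ)) *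
        ((((χ₁ (diagUnit (t : borelAdelic F E c 3).2 0) : ℂˣ) : ℂ) * conj ((ξ (diagUnit (t : borelAdelic F E c 3).2 0) : ℂˣ) : ℂ)) * R (diagUnit (t : borelAdelic F E c 3).2 0)))
    {Φm : (AdeleRing (𝓞 E) E)ˣ → ℝ≥0∞} (hΦmm : Measurable Φm) (hΦminv : ∀ k ∈ GaloisRepresentations.principalIdeles E, ∀ x, Φm (k * x) = Φm x)
    (hmaj : ∀ (t : ↥(torusInBorel F E c 3)) (k : ((standardMaximalCompactGL 3 E).comap (adelicVal F E c 3 ((StdForm.antidiagonal 3).over E)) : Subgroup (quasiSplit F E c 3).Adelic)), ‖Ψ (((t : borelAdelic F E c 3) : (quasiSplit F E c 3).Adelic) * (k : (quasiSplit F E c 3).Adelic))‖ₑ ≤ Φm (diagUnit (t : borelAdelic F E c 3).2 0))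
    (hfin : ∫⁻ x in 𝓕, (((IdeleClassGroup.ideleNorm E x * IdeleClassGroup.ideleNorm E x)⁻¹ : ℝ≥0) : ℝ≥0∞) * Φm x ∂νI < ∞) :
    Integrable (fun g => (β g).toReal • Ψ g) νG ∧ ∫ g, (β g).toReal • Ψ g ∂νG = 0 := by
  haveI : BorelSpace ↥(borelAdelic F E c 3) := Subtype.borelSpace _
  haveI : BorelSpace ↥(torusInBorel F E c 3) := Subtype.borelSpace _
  have hχc : ∀ χ : HeckeCharacter E, Continuous fun x : (AdeleRing (𝓞 E) E)ˣ => ((χ x : ℂˣ) : ℂ) := fun χ => Units.continuous_val.comp (map_continuous χ)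
  have hn2 : ∀ u : ↥(TorusDict.torus c), ‖((χ₂ u : ℂˣ) : ℂ)‖ = 1 := norm_torusHom_apply_eq_one_of_isAutomorphic F E c h2 hc1 χ₂ hχ₂
  have hn2' : ∀ u : ↥(TorusDict.torus c), ‖((χ₂' u : ℂˣ) : ℂ)‖ = 1 := norm_torusHom_apply_eq_one_of_isAutomorphic F E c h2 hc1 χ₂' hχ₂'
  -- the idele-side function `Φ = (χ₁ conj ξ)·R`
  set Φ : (AdeleRing (𝓞 E) E)ˣ → ℂ := fun x => (((χ₁ x : ℂˣ) : ℂ) * conj ((ξ x : ℂˣ) : ℂ)) * R x with hΦ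
  have hΦm : Measurable Φ := (((hχc χ₁).measurable).mul (continuous_conj.measurable.comp (hχc ξ).measurable)).mul hRm
  have hΦinv : ∀ k ∈ GaloisRepresentations.principalIdeles E, ∀ x, Φ (k * x) = Φ x := fun k hk x => by
    simp only [hΦ, map_mul, HeckeCharacter.map_principal χ₁ hk, HeckeCharacter.map_principal ξ hk, one_mul, hR k (ideleNorm_principal hk) x]
  -- the middle-entry torus character `η`
  obtain ⟨η, hηc, hηapply⟩ := exists_middleEntryChar (F := F) (E := E) (c := c) χ₂ χ₂'
  have hK' : ∀ t : ↥(torusInBorel F E c 3), ∫ k, Ψ (((t : borelAdelic F E c 3) : (quasiSplit F E c 3).Adelic) * (k : (quasiSplit F E c 3).Adelic)) ∂μK = η t * Φ (diagUnit (t : borelAdelic F E c 3).2 0) := fun t => by rw [hK t, hηapply]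
  have hη1 : ∀ t, ‖η t‖ = 1 := fun t => by rw [hηapply, norm_mul, Complex.norm_conj, hn2, hn2', mul_one]
  have hηΓ : ∀ τ : ↥((rationalBorel F E c 3).subgroupOf (torusInBorel F E c 3)), η (τ : ↥(torusInBorel F E c 3)) = 1 := fun τ => by
    rw [hηapply, apply_middleEntryUnitary_rationalTorus_eq_one hχ₂ τ, apply_middleEntryUnitary_rationalTorus_eq_one hχ₂' τ, Units.val_one, map_one, mul_one]
  by_cases h2e : χ₂ = χ₂'
  · -- `χ₂ = χ₂′`: `η ≡ 1`; push to `E^×∖𝕀_E` (★ (δ)₃) and kill by Lemma B (★ GR-χ)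
    have hnt : ¬ (χ₁ * ξ⁻¹).IsNormTwist := hna.resolve_left (not_not.2 h2e)
    have hη : ∀ t, η t = 1 := fun t => by
      rw [hηapply, ← h2e, Complex.mul_conj', hn2]; norm_num
    obtain ⟨K, -, -, -, hδ⟩ := exists_integral_weight_smul_eq_mul_setIntegral_ideleClass_three h2 hc hc1 νG μK νI hBK h𝓕
    obtain ⟨hI, -, hE⟩ := hδ β hβ Ψ hΨm hΨN hΨB Φ hΦm hΦinv (fun t => by rw [hK' t, hη t, one_mul]) Φm hΦmm hΦminv hmaj hfin
    have hnorm : ∀ a : (AdeleRing (𝓞 E) E)ˣ, IdeleClassGroup.ideleNorm E a = 1 → ∀ x : (AdeleRing (𝓞 E) E)ˣ, ((IdeleClassGroup.ideleNorm E (a * x) : ℝ) * (IdeleClassGroup.ideleNorm E (a * x) : ℝ))⁻¹ = ((IdeleClassGroup.ideleNorm E x : ℝ) * (IdeleClassGroup.ideleNorm E x : ℝ))⁻¹ := fun a ha x => by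
      rw [map_mul, ha, one_mul]
    have hZ : ∫ x in 𝓕, ((IdeleClassGroup.ideleNorm E x : ℝ) * (IdeleClassGroup.ideleNorm E x : ℝ))⁻¹ • Φ x ∂νI = 0 := by
      simp only [hΦ]
      simp_rw [apply_mul_conj_apply_of_isUnitary χ₁ hξu]
      exact setIntegral_ideleClass_smul_mul_eq_zero_of_not_isNormTwist νI h𝓕 hnt hnorm hR
    exact ⟨hI, by rw [hE, hZ, mul_zero]⟩
  · -- `χ₂ ≠ χ₂′`: `η ≠ 1` on the fibre `ker d₀`; the `U(1)`-fibre kills the bracket (★ C3′)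
    obtain ⟨u, hu⟩ : ∃ u : ↥(TorusDict.torus c), χ₂ u ≠ χ₂' u := DFunLike.ne_iff.1 h2e
    obtain ⟨s, hs, hsu⟩ := exists_torus_diagUnit_zero_eq_one_and_middleEntryUnitary_eq (F := F) hc u
    have hηs : η s ≠ 1 := by
      intro h1
      rw [hηapply, hsu] at h1
      apply hu
      ext
      have h3 : ((χ₂ u : ℂˣ) : ℂ) * (conj ((χ₂' u : ℂˣ) : ℂ) * ((χ₂' u : ℂˣ) : ℂ)) = ((χ₂' u : ℂˣ) : ℂ) := by rw [← mul_assoc, h1, one_mul]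
      rwa [← Complex.normSq_eq_conj_mul_self, Complex.normSq_eq_norm_sq, hn2' u, one_pow, Complex.ofReal_one, mul_one] at h3
    exact integral_weight_smul_eq_zero_of_kAverage_eq_character_mul_three h2 hc hc1 νG μK νI hBK h𝓕 hβ hΨm hΨN hΨB η hηc.measurable hη1 hηΓ hs hηs hΦm hΦinv hK' hΦmm hΦminv hmaj hfin

end Engine

/-! ## §2 The CM pair `(L⁺, L, conj)`: the two weighted brackets of the unfolded inner product vanish -/

section CM

variable (L : Type) [Field L] [NumberField L] [IsCMField L]
variable [MeasurableSpace (quasiSplit (↥(maximalRealSubfield L)) L (IsCMField.complexConj L) 3).Adelic] [BorelSpace (quasiSplit (↥(maximalRealSubfield L)) L (IsCMField.complexConj L) 3).Adelic]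
variable [MeasurableSpace (AdeleRing (𝓞 L) L)ˣ] [BorelSpace (AdeleRing (𝓞 L) L)ˣ]

/-- **`[Ψ₁]_β = 0` — THE `w = 1` BRACKET**: `Ψ₁ = (f∘H)φ·conj((f′∘H)φ′)` for continuous bounded pair sections `φ ∈ (χ₁,χ₂)`, `φ′ ∈ (χ₁′,χ₂′)` (`χ₁′` unitary, `χ₂, χ₂′` automorphic), `f ∈ C_c((0,∞))`,
`f′` continuous of compact support: if `χ₂ ≠ χ₂′` or `χ₁χ₁′⁻¹` is not a norm twist, `(β).toReal • Ψ₁ ∈ L¹(ν_G)` and **`∫ (β g).toReal • Ψ₁ g dν_G = 0`** (§1 ENGINE with `ξ = χ₁′`,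
`R(x) = f(‖x‖)conj f′(‖x‖)·⟪φ,φ′⟫_K` by ★ C1; majorant `‖f(‖x‖)‖·C_φ‖f′‖_∞C_{φ′}`, finite by ★ C3 §4). [cite: MoeglinWaldspurger1995, II.2.1] [cite: Rogawski1990, §7.3 (pp. 96–98)] -/
theorem integral_weight_smul_wOne_eq_zero_cm_three
    (νG : Measure (quasiSplit (↥(maximalRealSubfield L)) L (IsCMField.complexConj L) 3).Adelic) [νG.IsHaarMeasure] (μK : Measure ((standardMaximalCompactGL 3 L).comap (adelicVal (↥(maximalRealSubfield L)) L (IsCMField.complexConj L) 3 ((StdForm.antidiagonal 3).over L)) : Subgroup (quasiSplit (↥(maximalRealSubfield L)) L (IsCMField.complexConj L) 3).Adelic)) [μK.IsHaarMeasure] (νI : Measure (AdeleRing (𝓞 L) L)ˣ) [νI.IsHaarMeasure]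
    {𝓕I : Set (AdeleRing (𝓞 L) L)ˣ} (h𝓕I : IsIdeleClassDomain L 𝓕I)
    {β : (quasiSplit (↥(maximalRealSubfield L)) L (IsCMField.complexConj L) 3).Adelic → ℝ≥0∞} (hβ : IsCoveringWeight ((arithmeticBorel (↥(maximalRealSubfield L)) L (IsCMField.complexConj L) 3).map (quasiSplit (↥(maximalRealSubfield L)) L (IsCMField.complexConj L) 3).arithmeticSubgroup.subtype) β)
    {χ₁ χ₁' : HeckeCharacter L} {χ₂ χ₂' : ↥(TorusDict.torus (IsCMField.complexConj L)) →ₜ* ℂˣ} {φ φ' : (quasiSplit (↥(maximalRealSubfield L)) L (IsCMField.complexConj L) 3).Adelic → ℂ}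
    (hχ₁'u : χ₁'.IsUnitary) (hχ₂ : TorusDict.IsAutomorphic (IsCMField.complexConj L) χ₂) (hχ₂' : TorusDict.IsAutomorphic (IsCMField.complexConj L) χ₂')
    (hna : χ₂ ≠ χ₂' ∨ ¬ (χ₁ * χ₁'⁻¹).IsNormTwist)
    (hφ : IsChiSectionPair χ₁ χ₂ φ) (hφc : Continuous φ) {Cφ : ℝ} (hφC : ∀ x, ‖φ x‖ ≤ Cφ)
    (hφ' : IsChiSectionPair χ₁' χ₂' φ') (hφ'c : Continuous φ') {Cφ' : ℝ} (hφ'C : ∀ x, ‖φ' x‖ ≤ Cφ')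
    {f f' : ℝ → ℂ} (hf : Continuous f) (hfs : HasCompactSupport f) (hf0 : tsupport f ⊆ Ioi 0) (hf' : Continuous f') (hf's : HasCompactSupport f') :
    Integrable (fun g : (quasiSplit (↥(maximalRealSubfield L)) L (IsCMField.complexConj L) 3).Adelic => (β g).toReal • (f (borelHeight g : ℝ) * φ g * conj (f' (borelHeight g : ℝ) * φ' g))) νG ∧
      ∫ g : (quasiSplit (↥(maximalRealSubfield L)) L (IsCMField.complexConj L) 3).Adelic, (β g).toReal • (f (borelHeight g : ℝ) * φ g * conj (f' (borelHeight g : ℝ) * φ' g)) ∂νG = 0 := by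
  haveI := t2Space_adeleRing_of_numberField L
  haveI := locallyCompactSpace_adeleRing' L
  have hc : IsCMField.complexConj L * IsCMField.complexConj L = 1 := AlgEquiv.ext fun x => IsCMField.complexConj_apply_apply L x
  have hc1 : IsCMField.complexConj L ≠ 1 := IsCMField.complexConj_ne_one L
  have h2 := Algebra.IsQuadraticExtension.finrank_eq_two (↥(maximalRealSubfield L)) L
  have hBK := exists_mem_borelAdelic_mul_mem_standardMaximalCompactGL_cm L (N := 3)
  have hIc : Continuous fun x : (AdeleRing (𝓞 L) L)ˣ => (IdeleClassGroup.ideleNorm L x : ℝ) := NNReal.continuous_coe.comp (continuous_ideleNorm_holds L)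
  have hHc : Continuous fun g : (quasiSplit (↥(maximalRealSubfield L)) L (IsCMField.complexConj L) 3).Adelic => (borelHeight g : ℝ) := NNReal.continuous_coe.comp continuous_borelHeight
  have hCφ : 0 ≤ Cφ := (norm_nonneg _).trans (hφC 1)
  obtain ⟨B', hB'⟩ := hf's.exists_bound_of_continuous hf'
  have hB'0 : 0 ≤ B' := (norm_nonneg _).trans (hB' 1)
  have hφB := (K2E1BorelCosetsDictionary.forall_arithmeticBorel_iff (ψ := φ)).2 (hφ.toAdelic_mul hχ₂)
  have hφ'B := (K2E1BorelCosetsDictionary.forall_arithmeticBorel_iff (ψ := φ')).2 (hφ'.toAdelic_mul hχ₂')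
  have hHtk := borelHeight_torus_mul_maximalCompact_three (F := ↥(maximalRealSubfield L)) (E := L) (c := IsCMField.complexConj L)
  refine integral_weight_smul_eq_zero_of_kAverage_pairChar h2 hc hc1 νG μK νI hBK h𝓕I hβ
    (Ψ := fun g : (quasiSplit (↥(maximalRealSubfield L)) L (IsCMField.complexConj L) 3).Adelic => f (borelHeight g : ℝ) * φ g * conj (f' (borelHeight g : ℝ) * φ' g))
    ((((hf.comp hHc).measurable).mul hφc.measurable).mul (continuous_conj.measurable.comp (((hf'.comp hHc).measurable).mul hφ'c.measurable)))
    (fun n y => ?_) (fun b hb y => ?_) hχ₁'u hχ₂ hχ₂' hna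
    (R := fun x : (AdeleRing (𝓞 L) L)ˣ => f (IdeleClassGroup.ideleNorm L x : ℝ) * conj (f' (IdeleClassGroup.ideleNorm L x : ℝ)) * ∫ k : ((standardMaximalCompactGL 3 L).comap (adelicVal (↥(maximalRealSubfield L)) L (IsCMField.complexConj L) 3 ((StdForm.antidiagonal 3).over L)) : Subgroup (quasiSplit (↥(maximalRealSubfield L)) L (IsCMField.complexConj L) 3).Adelic), φ (k : (quasiSplit (↥(maximalRealSubfield L)) L (IsCMField.complexConj L) 3).Adelic) * conj (φ' (k : (quasiSplit (↥(maximalRealSubfield L)) L (IsCMField.complexConj L) 3).Adelic)) ∂μK)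
    ((((hf.comp hIc).measurable).mul (continuous_conj.measurable.comp (hf'.comp hIc).measurable)).mul measurable_const)
    (fun a ha x => by simp only [map_mul, ha, one_mul]) (fun t => ?_)
    (Φm := fun x : (AdeleRing (𝓞 L) L)ˣ => ‖f (IdeleClassGroup.ideleNorm L x : ℝ)‖ₑ * ENNReal.ofReal (Cφ * (B' * Cφ')))
    ((hf.comp hIc).measurable.enorm.mul_const _) (fun k hk x => by simp only [map_mul, ideleNorm_principal hk, one_mul]) (fun t k => ?_)
    (setLIntegral_normSq_inv_mul_enorm_comp_lt_top νI h𝓕I hf hfs hf0 ENNReal.ofReal_ne_top)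
  · -- left-`N(𝔸)`-invariance
    have hn := (mem_unipotentInBorel_iff _).1 n.2
    simp only [borelHeight_unipotent_mul hn, hφ.unipotent_mul ⟨_, hn⟩ y, hφ'.unipotent_mul ⟨_, hn⟩ y]
  · -- left-`B(L⁺)`-invariance
    simp only [K2E1TruncatedEisensteinExplicit.borelHeight_arithmeticBorel_mul hb, hφB b hb y, hφ'B b hb y]
  · -- the `K_U`-average (★ C1)
    rw [integral_maximalCompact_torus_chiSectionPair_mul_conj μK hφ hφ' f f' t]
    ring
  · -- the majorant
    rw [enorm_mul, enorm_mul, hHtk t k, mul_assoc, ← ofReal_norm (φ _), ← ofReal_norm (conj _), ← ENNReal.ofReal_mul (norm_nonneg _), Complex.norm_conj, norm_mul]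
    exact mul_le_mul' le_rfl (ENNReal.ofReal_le_ofReal (mul_le_mul (hφC _) (mul_le_mul (hB' _) (hφ'C _) (norm_nonneg _) hB'0) (mul_nonneg (norm_nonneg _) (norm_nonneg _)) hCφ))

/-- **`[Ψ₂]_β = 0` — THE `w = w₀` BRACKET**: `Ψ₂ = (f∘H)φ·conj J` where `J` is Borel, left-`N(𝔸)`- and left-`B(L⁺)`-invariant and `J(g) = κ • ∫_{N(𝔸)} f′(H(W v g))·φ′(W v g) dν` (in C4b:
`J = θ′_B − (f′∘H)φ′`, `κ = (ν𝓕)⁻¹`, ★ C2): if `χ₂ ≠ χ₂′` or `χ₁(χ₁′ʷ)⁻¹` is not a norm twist, `(β).toReal • Ψ₂ ∈ L¹(ν_G)` and **`∫ (β g).toReal • Ψ₂ g dν_G = 0`** (§1 ENGINE with `ξ = χ₁′ʷ`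
(unitary ★), `R(x) = f(‖x‖)·‖x‖²·∫_{K_U}φ(k)conj(κ•∫_{N(𝔸)}f′(‖x‖⁻¹H(W v k))φ′(W v k)dν)dμ_K` by ★ C3 §2 — Borel by two parametric integrals; majorant `‖f(‖x‖)‖·C_φ|κ|T²D` by ★ C3 §1 + §5
and the cut-off `T` of `f`; finite by ★ C3 §4). [cite: MoeglinWaldspurger1995, II.2.1] [cite: Rogawski1990, §7.3 (pp. 96–98)] -/
theorem integral_weight_smul_wZero_eq_zero_cm_three
    (νG : Measure (quasiSplit (↥(maximalRealSubfield L)) L (IsCMField.complexConj L) 3).Adelic) [νG.IsHaarMeasure] (μK : Measure ((standardMaximalCompactGL 3 L).comap (adelicVal (↥(maximalRealSubfield L)) L (IsCMField.complexConj L) 3 ((StdForm.antidiagonal 3).over L)) : Subgroup (quasiSplit (↥(maximalRealSubfield L)) L (IsCMField.complexConj L) 3).Adelic)) [μK.IsHaarMeasure] (νI : Measure (AdeleRing (𝓞 L) L)ˣ) [νI.IsHaarMeasure]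
    {𝓕I : Set (AdeleRing (𝓞 L) L)ˣ} (h𝓕I : IsIdeleClassDomain L 𝓕I)
    (ν : Measure ↥(adelicUnipotent (↥(maximalRealSubfield L)) L (IsCMField.complexConj L) 3)) [ν.IsHaarMeasure] [ν.IsInvInvariant] [SFinite ν] {𝓕 : Set ↥(adelicUnipotent (↥(maximalRealSubfield L)) L (IsCMField.complexConj L) 3)}
    (h𝓕N : IsFundamentalDomain ↥(rationalUnipotent (↥(maximalRealSubfield L)) L (IsCMField.complexConj L) 3) 𝓕 ν) (h𝓕c : IsCompact (closure 𝓕))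
    {β : (quasiSplit (↥(maximalRealSubfield L)) L (IsCMField.complexConj L) 3).Adelic → ℝ≥0∞} (hβ : IsCoveringWeight ((arithmeticBorel (↥(maximalRealSubfield L)) L (IsCMField.complexConj L) 3).map (quasiSplit (↥(maximalRealSubfield L)) L (IsCMField.complexConj L) 3).arithmeticSubgroup.subtype) β)
    {χ₁ χ₁' : HeckeCharacter L} {χ₂ χ₂' : ↥(TorusDict.torus (IsCMField.complexConj L)) →ₜ* ℂˣ} {φ φ' : (quasiSplit (↥(maximalRealSubfield L)) L (IsCMField.complexConj L) 3).Adelic → ℂ}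
    (hχ₁'u : χ₁'.IsUnitary) (hχ₂ : TorusDict.IsAutomorphic (IsCMField.complexConj L) χ₂) (hχ₂' : TorusDict.IsAutomorphic (IsCMField.complexConj L) χ₂')
    (hna : χ₂ ≠ χ₂' ∨ ¬ (χ₁ * (reflectChar (IsCMField.complexConj L) χ₁')⁻¹).IsNormTwist)
    (hφ : IsChiSectionPair χ₁ χ₂ φ) (hφc : Continuous φ) {Cφ : ℝ} (hφC : ∀ x, ‖φ x‖ ≤ Cφ)
    (hφ' : IsChiSectionPair χ₁' χ₂' φ') (hφ'c : Continuous φ') {Cφ' : ℝ} (hφ'C : ∀ x, ‖φ' x‖ ≤ Cφ')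
    {f f' : ℝ → ℂ} (hf : Continuous f) (hfs : HasCompactSupport f) (hf0 : tsupport f ⊆ Ioi 0) (hf' : Continuous f') (hf's : HasCompactSupport f') (hf'0 : tsupport f' ⊆ Ioi 0)
    (κ : ℝ) {J : (quasiSplit (↥(maximalRealSubfield L)) L (IsCMField.complexConj L) 3).Adelic → ℂ} (hJm : Measurable J)
    (hJN : ∀ (n : ↥(unipotentInBorel (↥(maximalRealSubfield L)) L (IsCMField.complexConj L) 3)) (y : (quasiSplit (↥(maximalRealSubfield L)) L (IsCMField.complexConj L) 3).Adelic), J (((n : borelAdelic (↥(maximalRealSubfield L)) L (IsCMField.complexConj L) 3) : (quasiSplit (↥(maximalRealSubfield L)) L (IsCMField.complexConj L) 3).Adelic) * y) = J y)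
    (hJB : ∀ b ∈ arithmeticBorel (↥(maximalRealSubfield L)) L (IsCMField.complexConj L) 3, ∀ y : (quasiSplit (↥(maximalRealSubfield L)) L (IsCMField.complexConj L) 3).Adelic, J ((b : (quasiSplit (↥(maximalRealSubfield L)) L (IsCMField.complexConj L) 3).Adelic) * y) = J y)
    (hJ : ∀ g : (quasiSplit (↥(maximalRealSubfield L)) L (IsCMField.complexConj L) 3).Adelic, J g = κ • ∫ v : ↥(adelicUnipotent (↥(maximalRealSubfield L)) L (IsCMField.complexConj L) 3), f' (borelHeight ((quasiSplit (↥(maximalRealSubfield L)) L (IsCMField.complexConj L) 3).toAdelic (weylLongU ((IsCMField.complexConj L : L ≃ₐ[↥(maximalRealSubfield L)] L) : L →+* L) (rfl : (StdForm.antidiagonal 3).over L = (StdForm.antidiagonal 3).over L)) * (v : (quasiSplit (↥(maximalRealSubfield L)) L (IsCMField.complexConj L) 3).Adelic) * g) : ℝ) * φ' ((quasiSplit (↥(maximalRealSubfield L)) L (IsCMField.complexConj L) 3).toAdelic (weylLongU ((IsCMField.complexConj L : L ≃ₐ[↥(maximalRealSubfield L)] L) : L →+* L) (rfl : (StdForm.antidiagonal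 3).over L = (StdForm.antidiagonal 3).over L)) * (v : (quasiSplit (↥(maximalRealSubfield L)) L (IsCMField.complexConj L) 3).Adelic) * g) ∂ν) :
    Integrable (fun g : (quasiSplit (↥(maximalRealSubfield L)) L (IsCMField.complexConj L) 3).Adelic => (β g).toReal • (f (borelHeight g : ℝ) * φ g * conj (J g))) νG ∧
      ∫ g : (quasiSplit (↥(maximalRealSubfield L)) L (IsCMField.complexConj L) 3).Adelic, (β g).toReal • (f (borelHeight g : ℝ) * φ g * conj (J g)) ∂νG = 0 := by
  haveI := t2Space_adeleRing_of_numberField L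
  haveI := locallyCompactSpace_adeleRing' L
  haveI := secondCountableTopology_adeleRing L
  haveI : SecondCountableTopology (quasiSplit (↥(maximalRealSubfield L)) L (IsCMField.complexConj L) 3).Adelic := inferInstanceAs (SecondCountableTopology (adelic (↥(maximalRealSubfield L)) L (IsCMField.complexConj L) 3 ((StdForm.antidiagonal 3).over L)))
  have hc : IsCMField.complexConj L * IsCMField.complexConj L = 1 := AlgEquiv.ext fun x => IsCMField.complexConj_apply_apply L x
  have hc1 : IsCMField.complexConj L ≠ 1 := IsCMField.complexConj_ne_one L
  have h2 := Algebra.IsQuadraticExtension.finrank_eq_two (↥(maximalRealSubfield L)) L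
  have hBK := exists_mem_borelAdelic_mul_mem_standardMaximalCompactGL_cm L (N := 3)
  have hKc : IsCompact ((((standardMaximalCompactGL 3 L).comap (adelicVal (↥(maximalRealSubfield L)) L (IsCMField.complexConj L) 3 ((StdForm.antidiagonal 3).over L)) : Subgroup (quasiSplit (↥(maximalRealSubfield L)) L (IsCMField.complexConj L) 3).Adelic)) : Set (quasiSplit (↥(maximalRealSubfield L)) L (IsCMField.complexConj L) 3).Adelic) := isCompact_comap_adelicVal_standardMaximalCompactGL
  haveI : CompactSpace ((standardMaximalCompactGL 3 L).comap (adelicVal (↥(maximalRealSubfield L)) L (IsCMField.complexConj L) 3 ((StdForm.antidiagonal 3).over L)) : Subgroup (quasiSplit (↥(maximalRealSubfield L)) L (IsCMField.complexConj L) 3).Adelic) := isCompact_iff_compactSpace.1 hKc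
  haveI : IsFiniteMeasure μK := CompactSpace.isFiniteMeasure
  have hIm : Measurable fun x : (AdeleRing (𝓞 L) L)ˣ => IdeleClassGroup.ideleNorm L x := (continuous_ideleNorm_holds L).measurable
  have hIc : Continuous fun x : (AdeleRing (𝓞 L) L)ˣ => (IdeleClassGroup.ideleNorm L x : ℝ) := NNReal.continuous_coe.comp (continuous_ideleNorm_holds L)
  have hHc : Continuous fun g : (quasiSplit (↥(maximalRealSubfield L)) L (IsCMField.complexConj L) 3).Adelic => (borelHeight g : ℝ) := NNReal.continuous_coe.comp continuous_borelHeight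
  have hCφ : 0 ≤ Cφ := (norm_nonneg _).trans (hφC 1)
  have hχw'u : (reflectChar (IsCMField.complexConj L) χ₁').IsUnitary := fun a => norm_reflectChar_apply_of_isUnitary hχ₁'u a
  have hn2' : ∀ u : ↥(TorusDict.torus (IsCMField.complexConj L)), ‖((χ₂' u : ℂˣ) : ℂ)‖ = 1 :=
    norm_torusHom_apply_eq_one_of_isAutomorphic (↥(maximalRealSubfield L)) L (IsCMField.complexConj L) h2 hc1 χ₂' hχ₂'
  obtain ⟨T, hT, hhi, hlo⟩ := exists_one_le_forall_eq_zero hfs hf0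
  have hT0 : (0 : ℝ) < T := by exact_mod_cast one_pos.trans_le hT
  obtain ⟨D, hD0, hD⟩ := exists_bound_integral_comp_borelHeight_mul_weylLongU_cm_three L ν h𝓕N h𝓕c hf' hf's hf'0 hφ'C hT
  have hφB := (K2E1BorelCosetsDictionary.forall_arithmeticBorel_iff (ψ := φ)).2 (hφ.toAdelic_mul hχ₂)
  have hHtk := borelHeight_torus_mul_maximalCompact_three (F := ↥(maximalRealSubfield L)) (E := L) (c := IsCMField.complexConj L)
  set W : (quasiSplit (↥(maximalRealSubfield L)) L (IsCMField.complexConj L) 3).Adelic := (quasiSplit (↥(maximalRealSubfield L)) L (IsCMField.complexConj L) 3).toAdelic (weylLongU ((IsCMField.complexConj L : L ≃ₐ[↥(maximalRealSubfield L)] L) : L →+* L) (rfl : (StdForm.antidiagonal 3).over L = (StdForm.antidiagonal 3).over L)) with hW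
  have hassoc : ∀ (v : ↥(adelicUnipotent (↥(maximalRealSubfield L)) L (IsCMField.complexConj L) 3)) (g : (quasiSplit (↥(maximalRealSubfield L)) L (IsCMField.complexConj L) 3).Adelic), W * (v : (quasiSplit (↥(maximalRealSubfield L)) L (IsCMField.complexConj L) 3).Adelic) * g = W * ((v : (quasiSplit (↥(maximalRealSubfield L)) L (IsCMField.complexConj L) 3).Adelic) * g) := fun v g => mul_assoc _ _ _
  -- `R₂` and its measurability (two parametric integrals of jointly measurable integrands)
  set R₂ : (AdeleRing (𝓞 L) L)ˣ → ℂ := fun x => ∫ k : ((standardMaximalCompactGL 3 L).comap (adelicVal (↥(maximalRealSubfield L)) L (IsCMField.complexConj L) 3 ((StdForm.antidiagonal 3).over L)) : Subgroup (quasiSplit (↥(maximalRealSubfield L)) L (IsCMField.complexConj L) 3).Adelic), φ (k : (quasiSplit (↥(maximalRealSubfield L)) L (IsCMField.complexConj L) 3).Adelic) * conj (κ • ∫ v : ↥(adelicUnipotent (↥(maximalRealSubfield L)) L (IsCMField.complexConj L) 3),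
      f' ((((IdeleClassGroup.ideleNorm L x)⁻¹ * borelHeight (W * ((v : (quasiSplit (↥(maximalRealSubfield L)) L (IsCMField.complexConj L) 3).Adelic) * (k : (quasiSplit (↥(maximalRealSubfield L)) L (IsCMField.complexConj L) 3).Adelic))) : ℝ≥0) : ℝ)) * φ' (W * ((v : (quasiSplit (↥(maximalRealSubfield L)) L (IsCMField.complexConj L) 3).Adelic) * (k : (quasiSplit (↥(maximalRealSubfield L)) L (IsCMField.complexConj L) 3).Adelic))) ∂ν) ∂μK with hR₂
  have hmW : Continuous fun q : ((AdeleRing (𝓞 L) L)ˣ × ((standardMaximalCompactGL 3 L).comap (adelicVal (↥(maximalRealSubfield L)) L (IsCMField.complexConj L) 3 ((StdForm.antidiagonal 3).over L)) : Subgroup (quasiSplit (↥(maximalRealSubfield L)) L (IsCMField.complexConj L) 3).Adelic)) × ↥(adelicUnipotent (↥(maximalRealSubfield L)) L (IsCMField.complexConj L) 3) => W * ((q.2 : (quasiSplit (↥(maximalRealSubfield L)) L (IsCMField.complexConj L) 3).Adelic) * (q.1.2 : (quasiSplit (↥(maximalRealSubfield L)) L (IsCMField.complexConj L) 3).Adelic))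 :=
    continuous_const.mul ((continuous_subtype_val.comp continuous_snd).mul (continuous_subtype_val.comp (continuous_snd.comp continuous_fst)))
  have hjm : Measurable fun q : ((AdeleRing (𝓞 L) L)ˣ × ((standardMaximalCompactGL 3 L).comap (adelicVal (↥(maximalRealSubfield L)) L (IsCMField.complexConj L) 3 ((StdForm.antidiagonal 3).over L)) : Subgroup (quasiSplit (↥(maximalRealSubfield L)) L (IsCMField.complexConj L) 3).Adelic)) × ↥(adelicUnipotent (↥(maximalRealSubfield L)) L (IsCMField.complexConj L) 3) =>
      f' ((((IdeleClassGroup.ideleNorm L q.1.1)⁻¹ * borelHeight (W * ((q.2 : (quasiSplit (↥(maximalRealSubfield L)) L (IsCMField.complexConj L) 3).Adelic) * (q.1.2 : (quasiSplit (↥(maximalRealSubfield L)) L (IsCMField.complexConj L) 3).Adelic))) : ℝ≥0) : ℝ)) * φ' (W * ((q.2 : (quasiSplit (↥(maximalRealSubfield L)) L (IsCMField.complexConj L) 3).Adelic) * (q.1.2 : (quasiSplit (↥(maximalRealSubfield L)) L (IsCMField.complexConj L) 3).Adelic))) :=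
    (hf'.measurable.comp (measurable_coe_nnreal_real.comp (((hIm.comp (measurable_fst.comp measurable_fst)).inv).mul (measurable_borelHeight.comp hmW.measurable)))).mul
      (hφ'c.measurable.comp hmW.measurable)
  have hJ2m : Measurable fun p : (AdeleRing (𝓞 L) L)ˣ × ((standardMaximalCompactGL 3 L).comap (adelicVal (↥(maximalRealSubfield L)) L (IsCMField.complexConj L) 3 ((StdForm.antidiagonal 3).over L)) : Subgroup (quasiSplit (↥(maximalRealSubfield L)) L (IsCMField.complexConj L) 3).Adelic) => ∫ v : ↥(adelicUnipotent (↥(maximalRealSubfield L)) L (IsCMField.complexConj L) 3), f' ((((IdeleClassGroup.ideleNorm L p.1)⁻¹ * borelHeight (W * ((v : (quasiSplit (↥(maximalRealSubfield L)) L (IsCMField.complexConj L) 3).Adelic) * (p.2 : (quasiSplit (↥(maximalRealSubfield L)) L (IsCMField.complexConj L) 3).Adelic))) : ℝ≥0) : ℝ)) * φ' (W * ((v : (quasiSplit (↥(maximalRealSubfield L)) L (IsCMField.complexConj L) 3).Adelic) * (p.2 : (quasiSplit (↥(maximalRealSubfield L)) L (IsCMField.complexConj L) 3).Adelic))) ∂ν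 :=
    (hjm.stronglyMeasurable.integral_prod_right' (ν := ν)).measurable
  have hR2im : Measurable fun p : (AdeleRing (𝓞 L) L)ˣ × ((standardMaximalCompactGL 3 L).comap (adelicVal (↥(maximalRealSubfield L)) L (IsCMField.complexConj L) 3 ((StdForm.antidiagonal 3).over L)) : Subgroup (quasiSplit (↥(maximalRealSubfield L)) L (IsCMField.complexConj L) 3).Adelic) => φ (p.2 : (quasiSplit (↥(maximalRealSubfield L)) L (IsCMField.complexConj L) 3).Adelic) * conj (κ • ∫ v : ↥(adelicUnipotent (↥(maximalRealSubfield L)) L (IsCMField.complexConj L) 3), f' ((((IdeleClassGroup.ideleNorm L p.1)⁻¹ * borelHeight (W * ((v : (quasiSplit (↥(maximalRealSubfield L)) L (IsCMField.complexConj L) 3).Adelic) * (p.2 : (quasiSplit (↥(maximalRealSubfield L)) L (IsCMField.complexConj L) 3).Adelic))) : ℝ≥0) : ℝ)) * φ' (W * ((v : (quasiSplit (↥(maximalRealSubfield L)) L (IsCMField.complexConj L) 3).Adelic) * (p.2 : (quasiSplit (↥(maximalRealSubfield L)) L (IsCMField.complexConj L) 3).Adelic))) ∂ν) :=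
    (hφc.measurable.comp (measurable_subtype_coe.comp measurable_snd)).mul (continuous_conj.measurable.comp (hJ2m.const_smul κ))
  have hR₂m : Measurable R₂ := (hR2im.stronglyMeasurable.integral_prod_right' (ν := μK)).measurable
  refine integral_weight_smul_eq_zero_of_kAverage_pairChar h2 hc hc1 νG μK νI hBK h𝓕I hβ
    (Ψ := fun g : (quasiSplit (↥(maximalRealSubfield L)) L (IsCMField.complexConj L) 3).Adelic => f (borelHeight g : ℝ) * φ g * conj (J g))
    ((((hf.comp hHc).measurable).mul hφc.measurable).mul (continuous_conj.measurable.comp hJm))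
    (fun n y => ?_) (fun b hb y => ?_) hχw'u hχ₂ hχ₂' hna
    (R := fun x : (AdeleRing (𝓞 L) L)ˣ => f (IdeleClassGroup.ideleNorm L x : ℝ) * ((((IdeleClassGroup.ideleNorm L x : ℝ≥0) : ℝ) : ℂ) * (((IdeleClassGroup.ideleNorm L x : ℝ≥0) : ℝ) : ℂ)) * R₂ x)
    ((((hf.comp hIc).measurable).mul (((continuous_ofReal.comp hIc).measurable).mul ((continuous_ofReal.comp hIc).measurable))).mul hR₂m)
    (fun a ha x => by simp only [hR₂, map_mul, ha, one_mul]) (fun t => ?_)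
    (Φm := fun x : (AdeleRing (𝓞 L) L)ˣ => ‖f (IdeleClassGroup.ideleNorm L x : ℝ)‖ₑ * ENNReal.ofReal (Cφ * (|κ| * ((T : ℝ) * (T : ℝ) * D))))
    ((hf.comp hIc).measurable.enorm.mul_const _) (fun k hk x => by simp only [map_mul, ideleNorm_principal hk, one_mul]) (fun t k => ?_)
    (setLIntegral_normSq_inv_mul_enorm_comp_lt_top νI h𝓕I hf hfs hf0 ENNReal.ofReal_ne_top)
  · -- left-`N(𝔸)`-invariance
    have hn := (mem_unipotentInBorel_iff _).1 n.2
    simp only [borelHeight_unipotent_mul hn, hφ.unipotent_mul ⟨_, hn⟩ y, hJN n y]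
  · -- left-`B(L⁺)`-invariance
    simp only [K2E1TruncatedEisensteinExplicit.borelHeight_arithmeticBorel_mul hb, hφB b hb y, hJB b hb y]
  · -- the `K_U`-average (★ C3 §2)
    simp only [hJ, hR₂]
    rw [integral_maximalCompact_torus_chiSectionPair_mul_conj_wZero hc hc1 ν μK hφ hφ' hφ'c.measurable f hf'.measurable κ t]
    ring
  · -- the majorant (★ C3 §1 + §5, cut-off `T`)
    simp only [hJ]
    simp_rw [hassoc]
    rw [integral_comp_borelHeight_mul_weylLongU_torus_mul_eq_diagUnit hc hc1 ν hφ' hφ'c.measurable hf'.measurable t (k : (quasiSplit (↥(maximalRealSubfield L)) L (IsCMField.complexConj L) 3).Adelic), hHtk t k]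
    by_cases hz : f ((IdeleClassGroup.ideleNorm L (diagUnit (t : borelAdelic (↥(maximalRealSubfield L)) L (IsCMField.complexConj L) 3).2 0)) : ℝ) = 0
    · rw [hz]; simp only [zero_mul, enorm_zero, zero_le]
    · have hTr : (T : ℝ)⁻¹ ≤ (IdeleClassGroup.ideleNorm L (diagUnit (t : borelAdelic (↥(maximalRealSubfield L)) L (IsCMField.complexConj L) 3).2 0) : ℝ) := not_lt.1 fun h => hz (hlo _ h)
      have hrT : (IdeleClassGroup.ideleNorm L (diagUnit (t : borelAdelic (↥(maximalRealSubfield L)) L (IsCMField.complexConj L) 3).2 0) : ℝ) ≤ T := not_lt.1 fun h => hz (hhi _ h)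
      have hTr' : T⁻¹ ≤ IdeleClassGroup.ideleNorm L (diagUnit (t : borelAdelic (↥(maximalRealSubfield L)) L (IsCMField.complexConj L) 3).2 0) := by rw [← NNReal.coe_le_coe, NNReal.coe_inv]; exact hTr
      have hI := hD _ hTr' k
      rw [enorm_mul, enorm_mul, mul_assoc, ← ofReal_norm (φ _), ← ofReal_norm (conj _), ← ENNReal.ofReal_mul (norm_nonneg _), Complex.norm_conj]
      refine mul_le_mul' le_rfl (ENNReal.ofReal_le_ofReal ?_)
      rw [norm_smul, Real.norm_eq_abs, norm_mul, norm_mul, norm_mul, norm_mul, Complex.norm_of_nonneg (NNReal.coe_nonneg _), norm_reflectChar_apply_of_isUnitary hχ₁'u, hn2', mul_one, mul_one]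
      refine mul_le_mul (hφC _) (mul_le_mul_of_nonneg_left ?_ (abs_nonneg _)) (by positivity) hCφ
      exact mul_le_mul (mul_le_mul hrT hrT (NNReal.coe_nonneg _) hT0.le) hI (norm_nonneg _) (mul_nonneg hT0.le hT0.le)

end CM

end Summit.HodgeConjecture.HodgeConjecture.Cruxes.H413.K2E1ChiPseudoEisensteinWeightBracketsCMThree

end
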